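import Literature.MathematicalPhysics.QuantumFieldTheory.Balaban1983to89.Node00.N24GlueStage5
import Literature.MathematicalPhysics.QuantumFieldTheory.Balaban1983to89.Node00.Record5C

/-!
# NODE N24 · binder B2 AT THE RECORD PREDICATE OF RECORD `Node00.IsRecordOfRecord₅C F N D w` (C-binding of the [B10] leaf; pub-ymgap chair R434
# (Q2) = (C)) — the `₅C` twin of `Node00.N24GlueStage5`: glue by name, N13 quantified, design-E face, rung body

TRACK A (YM-PLAN §2d, node N24 of 28), seat `pub-ymgap-dag-n24-a` (-a KNIT-BY-NAME).  FIFTH N24 module, a NEW importing one (append-only growth): the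
theorems of `Node00.N24GlueStage5` (module 4, over node00-def's `Record5`) restated VERBATIM over THE RECORD PREDICATE OF RECORD `IsRecordOfRecord₅C`
(`Node00.Record5C`, seat node00-def g28: same Stage-5 objects `Stage5Params ∕ datumOfRecord₅`, the world's upstream blocks bound by the C-binding
`upOfRecord₅C θ P = B10CompactBinding.ofPrintedAllXPNC (carriers₃ θ (X P)) (Y P) (Z P) (V P) (W P)` — the [Balaban1985UV3] Thm 1 leaf in its COMPACT
reading, every other leaf the N-binding's).  `Rec₅ := fun F D w => Node00.IsRecordOfRecord₅C F 2 D w` is the predicate the route's rev-1 children are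
typed over (node00-def l.9496; plan D60 §9).  THEOREMS ONLY, def-free, sorry-free, standard axioms; CONVENTIONS OF RECORD of `Node00.Carriers` apply.

WHAT THE RECORD DISCHARGES (by name from `Node00.Record5C`): `hC` (`construction_eq_of_isRecordOfRecord₅C`), `hγ` (`gamma_pos_of_isRecordOfRecord₅C`),
the GUARDED (0.20) leaf (`rgFlow_of_smallCouplings_of_isRecordOfRecord₅C`), N01 ∕ N02 ∕ N04 (`b4 ∕ b5 ∕ b7_main_of_isRecordOfRecord₅C`), B1
(`isPrintedAveraged_of_isRecordOfRecord₅C`), all packaged in `endStatementBPrinted_of_isRecordOfRecord₅C_of_nodes`.  WHAT STAYS DECLARED: N03, N05–N13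
at the record world (binders BY NAME), `γ₀` with `w.γ ≤ γ₀`, the β-window as box bounds on `D.βfun` (lower bound UNPRINTED, census T09.F; upper bound
[Balaban1987RG1] p. 264) or as the whitelist's `BetaBoundsInInterval`.
* §1 `N24_nodes_of_children₅C`, `N24_at_record₅C` (+ `_of_betaBounds`, `'`, `_of_prop26`) — (B2) `B16.EndStatementBPrinted D.C` at a `₅C` record.
* §2 `₅C` does not read the world's exponent functions nor its window letters (`N24_isRecordOfRecord₅C_withExp ∕ _withEp ∕ _reletter`; the datum side is
  module 4's `N24_datumOfRecord₅_reletter`, the C-binding `upOfRecord₅C` does not read `θ.γ` either).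
* §3 `N24_at_record₅C_of_N13_exists` — N13 in the quantified reading «∃ (e₋, e₊)» ([Balaban1988Convergent] Cor. 3).
* §4 Design E over any record predicate REFINING `₅C` and closed under γ-lowering re-lettering (`N24_at_datumE_of_refines₅C`, `…_of_boxBounds`,
  `N24_B2_atRecordE_of_refines₅C`).  VACUITY NOTE: at `Rec := ₅C` ITSELF the per-datum stubs N03 ∧ N06 are jointly refutable exactly as over ₅ (the [B9]
  residual `Y` is free; `B9LeafUnpinnedRecord5` transported along `Record5C.isRecordOfRecord₅C_rebind_of_isRecordOfRecord₅`, the `b4 … b9` leaves of the two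
  bindings agreeing by `upOfRecord₅C_leaves`) — at `₅C` use the PER-WORLD faces §1–§3; §4 is for the carrier-pinning refinements `₆ ∕ ₇ ∕ ₈ → ₅C`.
* §5 `N24_stabilityB_body₅C` — the rung body at `SU(N)` (Stage-0 projection = item stmt-QuantumFields-19183's matrix at `N = 2`; count-neutral).

WHICH CHILD BLOCKS at the `₅C` record (2026-08-25T23:3xZ): THEOREMS — N01, N02, N04, N23, `hC`, `hγ`, guarded (0.20) (`Record5C`); N03 modulo the Prop. 2.6
census.  DECLARED — N05 [B8], N06 [B9], N07 [B11], N08 [B10] (compact reading at `₅C`: a theorem the day the residual [B10] run family is pinned to leaf-system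
tower runs, `B10CompactBinding.b10_main_of_upC`, seat dag-n08-a), N09 [B12], N10 [B13], N11 [B14] (by name modulo two slots at ₅, `B14NodeKnitRecord5`),
N12 [B15], N13 [B16] (exponents quantified); the β-box bounds (NODE O ∕ (D1)(D4); `b > 0` UNPRINTED).  ETA(N24) = max(N13, β-side, stage ₈).
HONEST FRAMING: kernel bookkeeping BY NAME; N24 is a COMPOSITE — NOT a node discharge, no count moves; cruxes junk-inhabited over ₅ ∕ ₅C by design until
stage ₈; one finite four-torus programme at fixed ε; NOT ℝ⁴ ∕ infinite volume ∕ OS ∕ mass gap ∕ Clay.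
-/

noncomputable section

namespace Literature.MathematicalPhysics.QuantumFieldTheory.Balaban1983to89.Node00

open DagBinding T4Continuum T4DatumAssembly
open B6KLevelCensusIndexV1 (KIdx kGeoG)
open B6Prop26Census2136KLevelV1 (kG)

variable {F : T4Family} {N : ℕ} [NeZero N]

/-! ## §1. (B2) at a `₅C` record -/

section AtRecordC

variable {D : FiniteEpsData F (SU N)} {w : WorldP}

/-- **`DagBinding.Nodes (leavesP w P)` at a `₅C` record from the ten open children** (N03, N05–N13 BY NAME), N01 ∕ N02 ∕ N04 being `Record5C`'s theorems
`b4 ∕ b5 ∕ b7_main_of_isRecordOfRecord₅C` (the C-binding's `b4 b5 b7` leaves are the N-binding's).  Conjunct order = `Nodes`. [cite: Balaban1989LargeFieldII, Thm 1 p.355 (the thirteen-paper chain; bookkeeping)] -/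
theorem N24_nodes_of_children₅C (h : IsRecordOfRecord₅C F N D w)
    (h03 : ∀ P : B12.RunParams, Dag.B6_main (leavesP w P)) (h05 : ∀ P : B12.RunParams, Dag.B8_main (leavesP w P))
    (h06 : ∀ P : B12.RunParams, Dag.B9_main (leavesP w P)) (h07 : ∀ P : B12.RunParams, Dag.B11_main (leavesP w P))
    (h08 : ∀ P : B12.RunParams, Dag.B10_main (leavesP w P)) (h09 : ∀ P : B12.RunParams, Dag.B12_main (leavesP w P))
    (h10 : ∀ P : B12.RunParams, Dag.B13_main (leavesP w P)) (h11 : ∀ P : B12.RunParams, Dag.B14_main (leavesP w P))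
    (h12 : ∀ P : B12.RunParams, Dag.B15_main (leavesP w P)) (h13 : ∀ P : B12.RunParams, Dag.B16_main (leavesP w P))
    (P : B12.RunParams) : Nodes (leavesP w P) :=
  ⟨b4_main_of_isRecordOfRecord₅C h P, b5_main_of_isRecordOfRecord₅C h P, h03 P, b7_main_of_isRecordOfRecord₅C h P, h05 P, h06 P, h08 P, h07 P,
    h09 P, h10 P, h11 P, h12 P, h13 P⟩

/-- **N24 · (B2) AT THE RECORD PREDICATE OF RECORD `₅C` — the glue by name.**  A `₅C` record `(D, w)`, `w.γ ≤ γ₀`, the ten open children at every run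
of `w`, and the box bounds `w.b ≤ D.βfun ≤ w.βup` on `]0, γ₀]^{k+1}` (`FlowStep.BetaLowerH` — UNPRINTED, T09.F; `FlowStep.BetaUpperH` — [Balaban1987RG1]
p. 264) give **`B16.EndStatementBPrinted D.C`**; `hC`, `hγ`, the guarded (0.20) and N01 ∕ N02 ∕ N04 come from the record
(`Record5C.endStatementBPrinted_of_isRecordOfRecord₅C_of_nodes`), `BetaBoundsInInterval` through `D.curries`. [cite: Balaban1989LargeFieldII, Thm 1 p.355 + p.391; Balaban1988Convergent, Cor. 3 (2.50) p.264; Balaban1987RG1, (0.20) p.256 and (1.22) p.264; Balaban1985UV3, Thm 1 p.257 (compact reading; bookkeeping over the pinned form)] -/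
theorem N24_at_record₅C (h : IsRecordOfRecord₅C F N D w) {γ₀ : ℝ} (hγ₀ : w.γ ≤ γ₀)
    (h03 : ∀ P : B12.RunParams, Dag.B6_main (leavesP w P)) (h05 : ∀ P : B12.RunParams, Dag.B8_main (leavesP w P))
    (h06 : ∀ P : B12.RunParams, Dag.B9_main (leavesP w P)) (h07 : ∀ P : B12.RunParams, Dag.B11_main (leavesP w P))
    (h08 : ∀ P : B12.RunParams, Dag.B10_main (leavesP w P)) (h09 : ∀ P : B12.RunParams, Dag.B12_main (leavesP w P))
    (h10 : ∀ P : B12.RunParams, Dag.B13_main (leavesP w P)) (h11 : ∀ P : B12.RunParams, Dag.B14_main (leavesP w P))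
    (h12 : ∀ P : B12.RunParams, Dag.B15_main (leavesP w P)) (h13 : ∀ P : B12.RunParams, Dag.B16_main (leavesP w P))
    (hlo : FlowStep.BetaLowerH w.b γ₀ D.βfun) (hhi : FlowStep.BetaUpperH w.βup γ₀ D.βfun) :
    B16.EndStatementBPrinted D.C := by
  refine endStatementBPrinted_of_isRecordOfRecord₅C_of_nodes h hγ₀
    (N24_nodes_of_children₅C h h03 h05 h06 h07 h08 h09 h10 h11 h12 h13) ?_
  rw [construction_eq_of_isRecordOfRecord₅C h]
  exact DagBinding.betaBoundsInInterval_of_boxBounds D.C.toB12 D.βfun D.curries hlo hhi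

/-- The same with the whitelist's β-binder `DagBinding.BetaBoundsInInterval D.C.toB12 γ₀ w.b w.βup` in place of the box bounds. [cite: Balaban1989LargeFieldII, Thm 1 p.355 + p.391; Balaban1987RG1, (1.22) p.264 (bookkeeping over the pinned form)] -/
theorem N24_at_record₅C_of_betaBounds (h : IsRecordOfRecord₅C F N D w) {γ₀ : ℝ} (hγ₀ : w.γ ≤ γ₀)
    (h03 : ∀ P : B12.RunParams, Dag.B6_main (leavesP w P)) (h05 : ∀ P : B12.RunParams, Dag.B8_main (leavesP w P))
    (h06 : ∀ P : B12.RunParams, Dag.B9_main (leavesP w P)) (h07 : ∀ P : B12.RunParams, Dag.B11_main (leavesP w P))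
    (h08 : ∀ P : B12.RunParams, Dag.B10_main (leavesP w P)) (h09 : ∀ P : B12.RunParams, Dag.B12_main (leavesP w P))
    (h10 : ∀ P : B12.RunParams, Dag.B13_main (leavesP w P)) (h11 : ∀ P : B12.RunParams, Dag.B14_main (leavesP w P))
    (h12 : ∀ P : B12.RunParams, Dag.B15_main (leavesP w P)) (h13 : ∀ P : B12.RunParams, Dag.B16_main (leavesP w P))
    (hβ : BetaBoundsInInterval D.C.toB12 γ₀ w.b w.βup) : B16.EndStatementBPrinted D.C := by
  refine endStatementBPrinted_of_isRecordOfRecord₅C_of_nodes h hγ₀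
    (N24_nodes_of_children₅C h h03 h05 h06 h07 h08 h09 h10 h11 h12 h13) ?_
  rw [construction_eq_of_isRecordOfRecord₅C h]
  exact hβ

/-- (B2) at a `₅C` record with `γ₀ := w.γ` (box bounds on the record's own interval; no `γ₀` binder). [cite: Balaban1989LargeFieldII, Thm 1 p.355 + p.391; Balaban1987RG1, (1.22) p.264 (bookkeeping)] -/
theorem N24_at_record₅C' (h : IsRecordOfRecord₅C F N D w)
    (h03 : ∀ P : B12.RunParams, Dag.B6_main (leavesP w P)) (h05 : ∀ P : B12.RunParams, Dag.B8_main (leavesP w P))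
    (h06 : ∀ P : B12.RunParams, Dag.B9_main (leavesP w P)) (h07 : ∀ P : B12.RunParams, Dag.B11_main (leavesP w P))
    (h08 : ∀ P : B12.RunParams, Dag.B10_main (leavesP w P)) (h09 : ∀ P : B12.RunParams, Dag.B12_main (leavesP w P))
    (h10 : ∀ P : B12.RunParams, Dag.B13_main (leavesP w P)) (h11 : ∀ P : B12.RunParams, Dag.B14_main (leavesP w P))
    (h12 : ∀ P : B12.RunParams, Dag.B15_main (leavesP w P)) (h13 : ∀ P : B12.RunParams, Dag.B16_main (leavesP w P))
    (hlo : FlowStep.BetaLowerH w.b w.γ D.βfun) (hhi : FlowStep.BetaUpperH w.βup w.γ D.βfun) :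
    B16.EndStatementBPrinted D.C :=
  N24_at_record₅C h le_rfl h03 h05 h06 h07 h08 h09 h10 h11 h12 h13 hlo hhi

/-- (B2) at a `₅C` record with N03 entered at its statement of record, modulo exactly the [Balaban1984PropagatorsII] Prop. 2.6 census
(`Record5C.b6_main_of_isRecordOfRecord₅C_of_prop26`). [cite: Balaban1989LargeFieldII, Thm 1 p.355 + p.391; Balaban1984PropagatorsII, Prop. 2.6 (2.136)–(2.140) p.247 (the displayed slot; bookkeeping)] -/
theorem N24_at_record₅C_of_prop26 (h : IsRecordOfRecord₅C F N D w) {γ₀ : ℝ} (hγ₀ : w.γ ≤ γ₀)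
    (h26 : ∀ θ : Stage3Params, θ.toStage1Params.Admissible →
      B6.Prop26Printed (fun i : KIdx θ.d₆ θ.ℓ₆ θ.hd' θ.hL' θ.b₀ θ.b₁ => kGeoG i) (fun i => kG i))
    (h05 : ∀ P : B12.RunParams, Dag.B8_main (leavesP w P))
    (h06 : ∀ P : B12.RunParams, Dag.B9_main (leavesP w P)) (h07 : ∀ P : B12.RunParams, Dag.B11_main (leavesP w P))
    (h08 : ∀ P : B12.RunParams, Dag.B10_main (leavesP w P)) (h09 : ∀ P : B12.RunParams, Dag.B12_main (leavesP w P))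
    (h10 : ∀ P : B12.RunParams, Dag.B13_main (leavesP w P)) (h11 : ∀ P : B12.RunParams, Dag.B14_main (leavesP w P))
    (h12 : ∀ P : B12.RunParams, Dag.B15_main (leavesP w P)) (h13 : ∀ P : B12.RunParams, Dag.B16_main (leavesP w P))
    (hlo : FlowStep.BetaLowerH w.b γ₀ D.βfun) (hhi : FlowStep.BetaUpperH w.βup γ₀ D.βfun) :
    B16.EndStatementBPrinted D.C :=
  N24_at_record₅C h hγ₀ (b6_main_of_isRecordOfRecord₅C_of_prop26 h26 h) h05 h06 h07 h08 h09 h10 h11 h12 h13 hlo hhi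

end AtRecordC

/-! ## §2. What `₅C` does not read: exponent functions and window letters of the world -/

section ReletterC

variable {D : FiniteEpsData F (SU N)} {w : WorldP}

/-- `₅C` is preserved when the world's (2.50) exponent functions are re-read. [cite: Balaban1988Convergent, Cor. 3 (2.50) p.264 (bookkeeping)] -/
theorem N24_isRecordOfRecord₅C_withExp (h : IsRecordOfRecord₅C F N D w) (em ep : ℝ → ℝ) :
    IsRecordOfRecord₅C F N D { w with em := em, ep := ep } := by
  obtain ⟨θ, hθ, hD, hC, hγ, hL, hup⟩ := h
  exact ⟨θ, hθ, hD, hC, hγ, hL, hup⟩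

/-- `₅C` is preserved when `ep` alone is re-read (closure under which the unquantified N13 stub is junk-refutable, n13-a `B16NodeKnitExponents` §3).
[cite: Balaban1988Convergent, Cor. 3 (2.50) p.264 (bookkeeping)] -/
theorem N24_isRecordOfRecord₅C_withEp (h : IsRecordOfRecord₅C F N D w) (ep : ℝ → ℝ) :
    IsRecordOfRecord₅C F N D { w with ep := ep } := by
  obtain ⟨θ, hθ, hD, hC, hγ, hL, hup⟩ := h
  exact ⟨θ, hθ, hD, hC, hγ, hL, hup⟩

/-- **`₅C` does not read the window letters**: a `₅C` record over `D` stays one over `D` when the world is re-lettered to any `γ' > 0`, `b' > 0`, `βup'`,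
`(e₋, e₊)` — witness `{θ with γ := γ'}` (the datum by module 4's `N24_datumOfRecord₅_reletter`; `θ.L` and the C-binding `upOfRecord₅C` do not read `θ.γ`).
[cite: Balaban1989LargeFieldII, Thm 1 p.355 («sufficiently small positive γ»; bookkeeping)] -/
theorem N24_isRecordOfRecord₅C_reletter (h : IsRecordOfRecord₅C F N D w) {γ' b' : ℝ} (hγ' : 0 < γ') (hb' : 0 < b') (βup' : ℝ)
    (em ep : ℝ → ℝ) :
    IsRecordOfRecord₅C F N D { w with γ := γ', b := b', b_pos := hb', βup := βup', em := em, ep := ep } := by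
  obtain ⟨θ, hθ, hD, hC, -, hL, hup⟩ := h
  exact ⟨{ θ with γ := γ' }, ⟨hθ.1, hγ'⟩, hD.trans (N24_datumOfRecord₅_reletter θ γ').symm, hC, rfl, hL, hup⟩

end ReletterC

/-! ## §3. (B2) at a `₅C` record with N13 in the quantified-exponent reading -/

section QuantifiedN13C

variable {D : FiniteEpsData F (SU N)} {w : WorldP}

/-- **N24 · (B2) at a `₅C` record, N13 read «∃ (e₋, e₊)»**: N03, N05–N12 at the record world, N13 at the world re-read with SOME exponent functions,
`w.γ ≤ γ₀`, box bounds on `D.βfun` ⇒ `B16.EndStatementBPrinted D.C` — the re-read world is again a `₅C` record over `D` (`N24_isRecordOfRecord₅C_withExp`),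
N01–N12 transported by `B16NodeKnitExponents.nodes_withExp_of`. [cite: Balaban1989LargeFieldII, Thm 1 p.355 + p.391; Balaban1988Convergent, Cor. 3 (2.50) p.264; Balaban1987RG1, (1.22) p.264 (bookkeeping over the pinned form)] -/
theorem N24_at_record₅C_of_N13_exists (h : IsRecordOfRecord₅C F N D w) {γ₀ : ℝ} (hγ₀ : w.γ ≤ γ₀)
    (h03 : ∀ P : B12.RunParams, Dag.B6_main (leavesP w P)) (h05 : ∀ P : B12.RunParams, Dag.B8_main (leavesP w P))
    (h06 : ∀ P : B12.RunParams, Dag.B9_main (leavesP w P)) (h07 : ∀ P : B12.RunParams, Dag.B11_main (leavesP w P))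
    (h08 : ∀ P : B12.RunParams, Dag.B10_main (leavesP w P)) (h09 : ∀ P : B12.RunParams, Dag.B12_main (leavesP w P))
    (h10 : ∀ P : B12.RunParams, Dag.B13_main (leavesP w P)) (h11 : ∀ P : B12.RunParams, Dag.B14_main (leavesP w P))
    (h12 : ∀ P : B12.RunParams, Dag.B15_main (leavesP w P))
    (h13 : ∃ em ep : ℝ → ℝ, ∀ P : B12.RunParams, Dag.B16_main (leavesP { w with em := em, ep := ep } P))
    (hlo : FlowStep.BetaLowerH w.b γ₀ D.βfun) (hhi : FlowStep.BetaUpperH w.βup γ₀ D.βfun) :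
    B16.EndStatementBPrinted D.C := by
  obtain ⟨em, ep, h16⟩ := h13
  have h' : IsRecordOfRecord₅C F N D { w with em := em, ep := ep } := N24_isRecordOfRecord₅C_withExp h em ep
  refine endStatementBPrinted_of_isRecordOfRecord₅C_of_nodes h' hγ₀ (fun P => ?_) ?_
  · exact B16NodeKnitExponents.nodes_withExp_of (b4_main_of_isRecordOfRecord₅C h P) (b5_main_of_isRecordOfRecord₅C h P) (h03 P)
      (b7_main_of_isRecordOfRecord₅C h P) (h05 P) (h06 P) (h08 P) (h07 P) (h09 P) (h10 P) (h11 P) (h12 P) (h16 P)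
  · show BetaBoundsInInterval w.C.toB12 γ₀ w.b w.βup
    rw [construction_eq_of_isRecordOfRecord₅C h]
    exact DagBinding.betaBoundsInInterval_of_boxBounds D.C.toB12 D.βfun D.curries hlo hhi

end QuantifiedN13C

/-! ## §4. Design E over a record predicate REFINING `₅C` -/

section DesignEC

variable {Rec : FiniteEpsData F (SU N) → WorldP → Prop}

/-- **N24ᴱ · (B2) FOR A DATUM — design E over ANY record predicate `Rec` refining `₅C` (the predicate of record) and closed under γ-LOWERING re-lettering**
(`hRec`, `hRL`; for `₅C` itself `hRL` is `N24_isRecordOfRecord₅C_reletter`): a `Rec`-world over `D`; N03, N05–N12 at EVERY `Rec`-world over `D`; N13 for SOME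
exponent functions at every `Rec`-world over `D` carrying them (`S_N13E` shape); SOME window `]0, γ₀]`, `γ₀ > 0`, SOME letters `0 < b`, `β⁺` with
`BetaBoundsInInterval D.C.toB12 γ₀ b β⁺` ([Balaban1987RG1] (1.22); `RenormalisationBetaE` shape) ⇒ `B16.EndStatementBPrinted D.C` — re-letter to
`(min w.γ γ₀, b, β⁺, e₋, e₊)`, thirteen nodes there, `Record5C.endStatementBPrinted_of_isRecordOfRecord₅C_of_nodes`.  VACUITY NOTE: at `Rec := ₅C` itself the
per-datum stubs N03 ∧ N06 are jointly refutable (free [B9] residual; `B9LeafUnpinnedRecord5` along `Record5C.isRecordOfRecord₅C_rebind_of_isRecordOfRecord₅`) —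
this face is for the carrier-pinning refinements `₆ ∕ ₇ ∕ ₈ → ₅C`; at `₅C` use §1–§3. [cite: Balaban1989LargeFieldII, Thm 1 p.355 + p.391; Balaban1988Convergent, Cor. 3 (2.50) p.264; Balaban1987RG1, (1.22) p.264 (bookkeeping; letters existential as in print)] -/
theorem N24_at_datumE_of_refines₅C
    (hRec : ∀ {D : FiniteEpsData F (SU N)} {w : WorldP}, Rec D w → IsRecordOfRecord₅C F N D w)
    (hRL : ∀ {D : FiniteEpsData F (SU N)} {w : WorldP} {γ' b' : ℝ} (hγ' : 0 < γ') (_ : γ' ≤ w.γ) (hb' : 0 < b') (βup' : ℝ) (em ep : ℝ → ℝ),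
      Rec D w → Rec D { w with γ := γ', b := b', b_pos := hb', βup := βup', em := em, ep := ep })
    {D : FiniteEpsData F (SU N)} (hex : ∃ w : WorldP, Rec D w)
    (h03 : ∀ w : WorldP, Rec D w → ∀ P : B12.RunParams, Dag.B6_main (leavesP w P))
    (h05 : ∀ w : WorldP, Rec D w → ∀ P : B12.RunParams, Dag.B8_main (leavesP w P))
    (h06 : ∀ w : WorldP, Rec D w → ∀ P : B12.RunParams, Dag.B9_main (leavesP w P))
    (h07 : ∀ w : WorldP, Rec D w → ∀ P : B12.RunParams, Dag.B11_main (leavesP w P))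
    (h08 : ∀ w : WorldP, Rec D w → ∀ P : B12.RunParams, Dag.B10_main (leavesP w P))
    (h09 : ∀ w : WorldP, Rec D w → ∀ P : B12.RunParams, Dag.B12_main (leavesP w P))
    (h10 : ∀ w : WorldP, Rec D w → ∀ P : B12.RunParams, Dag.B13_main (leavesP w P))
    (h11 : ∀ w : WorldP, Rec D w → ∀ P : B12.RunParams, Dag.B14_main (leavesP w P))
    (h12 : ∀ w : WorldP, Rec D w → ∀ P : B12.RunParams, Dag.B15_main (leavesP w P))
    (h13 : ∃ em ep : ℝ → ℝ, ∀ w : WorldP, Rec D w → w.em = em → w.ep = ep → ∀ P : B12.RunParams, Dag.B16_main (leavesP w P))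
    (hβ : ∃ γ₀ b βup : ℝ, 0 < γ₀ ∧ 0 < b ∧ BetaBoundsInInterval D.C.toB12 γ₀ b βup) :
    B16.EndStatementBPrinted D.C := by
  obtain ⟨w, hw⟩ := hex
  obtain ⟨em, ep, h16⟩ := h13
  obtain ⟨γ₀, b, βup, hγ₀, hb, hβ⟩ := hβ
  have hγ' : 0 < min w.γ γ₀ := lt_min (gamma_pos_of_isRecordOfRecord₅C (hRec hw)) hγ₀
  have hw' : Rec D { w with γ := min w.γ γ₀, b := b, b_pos := hb, βup := βup, em := em, ep := ep } :=
    hRL hγ' (min_le_left _ _) hb βup em ep hw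
  have h5 : IsRecordOfRecord₅C F N D { w with γ := min w.γ γ₀, b := b, b_pos := hb, βup := βup, em := em, ep := ep } := hRec hw'
  refine endStatementBPrinted_of_isRecordOfRecord₅C_of_nodes h5 (min_le_right w.γ γ₀)
    (N24_nodes_of_children₅C h5 (h03 _ hw') (h05 _ hw') (h06 _ hw') (h07 _ hw') (h08 _ hw') (h09 _ hw') (h10 _ hw') (h11 _ hw')
      (h12 _ hw') (h16 _ hw' rfl rfl)) ?_
  rw [construction_eq_of_isRecordOfRecord₅C h5]
  exact hβ

/-- Design E over a `₅C`-refinement with the window as BOX BOUNDS on `D.βfun` (through `D.curries`). [cite: Balaban1989LargeFieldII, Thm 1 p.355 + p.391; Balaban1987RG1, (1.22) p.264 (bookkeeping)] -/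
theorem N24_at_datumE_of_refines₅C_of_boxBounds
    (hRec : ∀ {D : FiniteEpsData F (SU N)} {w : WorldP}, Rec D w → IsRecordOfRecord₅C F N D w)
    (hRL : ∀ {D : FiniteEpsData F (SU N)} {w : WorldP} {γ' b' : ℝ} (hγ' : 0 < γ') (_ : γ' ≤ w.γ) (hb' : 0 < b') (βup' : ℝ) (em ep : ℝ → ℝ),
      Rec D w → Rec D { w with γ := γ', b := b', b_pos := hb', βup := βup', em := em, ep := ep })
    {D : FiniteEpsData F (SU N)} (hex : ∃ w : WorldP, Rec D w)
    (h03 : ∀ w : WorldP, Rec D w → ∀ P : B12.RunParams, Dag.B6_main (leavesP w P))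
    (h05 : ∀ w : WorldP, Rec D w → ∀ P : B12.RunParams, Dag.B8_main (leavesP w P))
    (h06 : ∀ w : WorldP, Rec D w → ∀ P : B12.RunParams, Dag.B9_main (leavesP w P))
    (h07 : ∀ w : WorldP, Rec D w → ∀ P : B12.RunParams, Dag.B11_main (leavesP w P))
    (h08 : ∀ w : WorldP, Rec D w → ∀ P : B12.RunParams, Dag.B10_main (leavesP w P))
    (h09 : ∀ w : WorldP, Rec D w → ∀ P : B12.RunParams, Dag.B12_main (leavesP w P))
    (h10 : ∀ w : WorldP, Rec D w → ∀ P : B12.RunParams, Dag.B13_main (leavesP w P))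
    (h11 : ∀ w : WorldP, Rec D w → ∀ P : B12.RunParams, Dag.B14_main (leavesP w P))
    (h12 : ∀ w : WorldP, Rec D w → ∀ P : B12.RunParams, Dag.B15_main (leavesP w P))
    (h13 : ∃ em ep : ℝ → ℝ, ∀ w : WorldP, Rec D w → w.em = em → w.ep = ep → ∀ P : B12.RunParams, Dag.B16_main (leavesP w P))
    (hβ : ∃ γ₀ b βup : ℝ, 0 < γ₀ ∧ 0 < b ∧ FlowStep.BetaLowerH b γ₀ D.βfun ∧ FlowStep.BetaUpperH βup γ₀ D.βfun) :
    B16.EndStatementBPrinted D.C := by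
  obtain ⟨γ₀, b, βup, hγ₀, hb, hlo, hhi⟩ := hβ
  exact N24_at_datumE_of_refines₅C hRec hRL hex h03 h05 h06 h07 h08 h09 h10 h11 h12 h13
    ⟨γ₀, b, βup, hγ₀, hb, DagBinding.betaBoundsInInterval_of_boxBounds D.C.toB12 D.βfun D.curries hlo hhi⟩

/-- **N24ᴱ AT CLUSTER LEVEL over a `₅C`-refinement** — «∀ D w, Rec D w → B16.EndStatementBPrinted D.C» from the children stated ONCE as stubs over `Rec`
(`AtRecord` ∕ `S_N13E` ∕ β-side-E shapes); cluster K1 a THEOREM below `₅C`; same VACUITY NOTE at `Rec := ₅C` itself. [cite: Balaban1989LargeFieldII, Thm 1 p.355 + p.391; Balaban1988Convergent, Cor. 3 (2.50) p.264 (bookkeeping)] -/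
theorem N24_B2_atRecordE_of_refines₅C
    (hRec : ∀ {D : FiniteEpsData F (SU N)} {w : WorldP}, Rec D w → IsRecordOfRecord₅C F N D w)
    (hRL : ∀ {D : FiniteEpsData F (SU N)} {w : WorldP} {γ' b' : ℝ} (hγ' : 0 < γ') (_ : γ' ≤ w.γ) (hb' : 0 < b') (βup' : ℝ) (em ep : ℝ → ℝ),
      Rec D w → Rec D { w with γ := γ', b := b', b_pos := hb', βup := βup', em := em, ep := ep })
    (S03 : ∀ (D : FiniteEpsData F (SU N)) (w : WorldP), Rec D w → ∀ P : B12.RunParams, Dag.B6_main (leavesP w P))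
    (S05 : ∀ (D : FiniteEpsData F (SU N)) (w : WorldP), Rec D w → ∀ P : B12.RunParams, Dag.B8_main (leavesP w P))
    (S06 : ∀ (D : FiniteEpsData F (SU N)) (w : WorldP), Rec D w → ∀ P : B12.RunParams, Dag.B9_main (leavesP w P))
    (S07 : ∀ (D : FiniteEpsData F (SU N)) (w : WorldP), Rec D w → ∀ P : B12.RunParams, Dag.B11_main (leavesP w P))
    (S08 : ∀ (D : FiniteEpsData F (SU N)) (w : WorldP), Rec D w → ∀ P : B12.RunParams, Dag.B10_main (leavesP w P))
    (S09 : ∀ (D : FiniteEpsData F (SU N)) (w : WorldP), Rec D w → ∀ P : B12.RunParams, Dag.B12_main (leavesP w P))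
    (S10 : ∀ (D : FiniteEpsData F (SU N)) (w : WorldP), Rec D w → ∀ P : B12.RunParams, Dag.B13_main (leavesP w P))
    (S11 : ∀ (D : FiniteEpsData F (SU N)) (w : WorldP), Rec D w → ∀ P : B12.RunParams, Dag.B14_main (leavesP w P))
    (S12 : ∀ (D : FiniteEpsData F (SU N)) (w : WorldP), Rec D w → ∀ P : B12.RunParams, Dag.B15_main (leavesP w P))
    (S13E : ∀ D : FiniteEpsData F (SU N), (∃ w : WorldP, Rec D w) →
      ∃ em ep : ℝ → ℝ, ∀ w : WorldP, Rec D w → w.em = em → w.ep = ep → ∀ P : B12.RunParams, Dag.B16_main (leavesP w P))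
    (SβE : ∀ (D : FiniteEpsData F (SU N)) (w : WorldP), Rec D w →
      ∃ γ₀ b βup : ℝ, 0 < γ₀ ∧ 0 < b ∧ BetaBoundsInInterval D.C.toB12 γ₀ b βup) :
    ∀ (D : FiniteEpsData F (SU N)) (w : WorldP), Rec D w → B16.EndStatementBPrinted D.C :=
  fun D w hw => N24_at_datumE_of_refines₅C hRec hRL ⟨w, hw⟩ (S03 D) (S05 D) (S06 D) (S07 D) (S08 D) (S09 D) (S10 D) (S11 D) (S12 D)
    (S13E D ⟨w, hw⟩) (SβE D w hw)

end DesignEC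

/-! ## §5. The rung-body face at `SU(N)` over the `₅C` record (count-neutral) -/

section RungC

variable {D : FiniteEpsData F (SU N)} {w : WorldP}

/-- **The per-family rung body at `SU(N)` FOR A `₅C` RECORD** — the `₅C` pair with (B2) and the window, and its Stage-0 projection `∃ D,
IsDatumOfRecord₀ F N D ∧ B16.EndStatementBPrinted D.C ∧ (window)` (at `N = 2` the matrix of route item stmt-QuantumFields-19183, HELD for rev 1): (B2) by
`N24_at_record₅C`, Stage 0 by `Record5C.isDatumOfRecord₀_of_isRecordOfRecord₅C`, window by `Node00.window_of_finiteEpsData` (zero-step runs; count-neutral).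
[cite: Balaban1989LargeFieldII, Thm 1 p.355 + p.391; Balaban1987RG1, (0.3)–(0.4) p.253 and (0.17) p.255 (bookkeeping)] -/
theorem N24_stabilityB_body₅C (h : IsRecordOfRecord₅C F N D w) {γ₀ : ℝ} (hγ₀ : w.γ ≤ γ₀)
    (h03 : ∀ P : B12.RunParams, Dag.B6_main (leavesP w P)) (h05 : ∀ P : B12.RunParams, Dag.B8_main (leavesP w P))
    (h06 : ∀ P : B12.RunParams, Dag.B9_main (leavesP w P)) (h07 : ∀ P : B12.RunParams, Dag.B11_main (leavesP w P))
    (h08 : ∀ P : B12.RunParams, Dag.B10_main (leavesP w P)) (h09 : ∀ P : B12.RunParams, Dag.B12_main (leavesP w P))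
    (h10 : ∀ P : B12.RunParams, Dag.B13_main (leavesP w P)) (h11 : ∀ P : B12.RunParams, Dag.B14_main (leavesP w P))
    (h12 : ∀ P : B12.RunParams, Dag.B15_main (leavesP w P)) (h13 : ∀ P : B12.RunParams, Dag.B16_main (leavesP w P))
    (hlo : FlowStep.BetaLowerH w.b γ₀ D.βfun) (hhi : FlowStep.BetaUpperH w.βup γ₀ D.βfun) :
    (∃ (D' : FiniteEpsData F (SU N)) (w' : WorldP), IsRecordOfRecord₅C F N D' w' ∧ B16.EndStatementBPrinted D'.C ∧
        ∃ γ₁ : ℝ, 0 < γ₁ ∧ ∀ γ : ℝ, 0 < γ → γ ≤ γ₁ → ∃ P : B12.RunParams, (D'.C P).flow.InInterval γ P.K) ∧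
      ∃ D' : FiniteEpsData F (SU N), IsDatumOfRecord₀ F N D' ∧ B16.EndStatementBPrinted D'.C ∧
        ∃ γ₁ : ℝ, 0 < γ₁ ∧ ∀ γ : ℝ, 0 < γ → γ ≤ γ₁ → ∃ P : B12.RunParams, (D'.C P).flow.InInterval γ P.K :=
  have hB : B16.EndStatementBPrinted D.C := N24_at_record₅C h hγ₀ h03 h05 h06 h07 h08 h09 h10 h11 h12 h13 hlo hhi
  ⟨⟨D, w, h, hB, window_of_finiteEpsData D⟩, ⟨D, isDatumOfRecord₀_of_isRecordOfRecord₅C h, hB, window_of_finiteEpsData D⟩⟩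

end RungC

end Literature.MathematicalPhysics.QuantumFieldTheory.Balaban1983to89.Node00

end
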